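import Summits.CriticalPhenomena.PercolationContinuityZ3.Theorems.Transplant.SkelDeepRoute
import HarnessLib

/-!
# L5.12/L5.13 companion (generic design-(D) re-typing) — the Step-IV input package over an ARBITRARY exploration graph `Γ ≤ G`
# (plain window graph `Skel.winGraph G w₀ R` for the root / face residues, habitat-restricted `Skel.winGraphIn G Ω` for the corridor
# residue; lane ruling p3-g4 2026-08-20 20:2xZ (4)(a): "every not-yet-typed Step-IV / kit file is GRAPH-PARAMETRIC")

builds on p205010 (kernel theorem, internal audit signed; external expert review pending) — nothing in this file uses p205010.
Lane `prim-bschramm`, seat `prim-bschramm-p3` (gen 4); helper file (`--supports stmt-CriticalPhenomena-4575 --as helper`).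

`SkelDeepRoute` proved the two probability transfers and the Step-IV inputs over the plain window graph `winGraph G w₀ R`.  The corridor
residue (C) explores the habitat graph `winGraphIn G Ω` instead (the (C) obstruction of p2-g4 / p5-g4, 2026-08-20), and L5.7 `kit_hIV` is to
be typed over an arbitrary `Γ`.  This file states the same facts for any `Γ ≤ G` and any vertex set `Q` whose inside `G`-edges are
`Γ`-edges (for `winGraph`: `Q ⊆ B_G(w₀, R)`, `adj_winGraph_of_subset_graphBall`; for `winGraphIn Ω`: `Q ⊆ Ω`):
* **`lattW_eq_of_le`** / **`real_bondPercolation_eq_of_le`** — `P_q^Γ(A) = P_q^G(A)` for `A` determined inside `Q`;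
* **`real_eq_of_isSubbox_of_le`** — `IsSubbox Γ Wt q D`, `Q ⊆ D` ⟹ `P_{Wt}(A) = P_q^G(A)` (the generic `real_cubeEvent_eq`);
* **`inputs_at_center_of_le`** (zone for `Γ` — antitone in the graph — and the cube links at scale `M` under `prodBernoulli Wt`),
  **`link_center_in`** / `link_seed_center_in` (a route link at any scale), and the package **`exists_stepIV_inputs_of_le`** (`M < ℓ` in `S`,
  `fatSeq c ℓ ⊆ D`, its inside `G`-edges `Γ`-edges ⟹ ONE `t ∈ Φ.types` with h1/h2/h3 of `KNLevels.stepIV_in (G := Γ)`).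
* **`hcon_of_straight`** (appended) — the straight route (prism `fatSeq c ℓ ⊆ D`, quarter-face `⊆ T`) discharges the probabilistic
  per-contact hypothesis `hcon` of the generic kit clause for every representative `t`.
The `winGraph` statements of `SkelDeepRoute` are the instances `Γ := winGraph G w₀ R`.

[cite: KozmaNitzan2024, §4 p. 17 (subbox: the induced measure on D is P_p), pp. 19–21 ((21)–(25)), p. 16 (hittable)]
-/

noncomputable section

open MeasureTheory

namespace Summit.CriticalPhenomena.PercolationContinuityZ3.Theorems

namespace Transplant

namespace Skel

open Literature.Probability.Percolation Literature.Probability.LatticeModels SimpleGraph KNLevels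
open Literature.Probability.Percolation.GM (HOct sp piece faceFin facePiece)
open Literature.Barriers.CriticalPhenomena (graphBall graphBall_finite mem_graphBall_self graphBall_mono)
open KozmaNitzan (wireSet_mono)
open scoped Classical

variable {V : Type} [DecidableEq V] {G : SimpleGraph V} [G.LocallyFinite] (Φ : PlanarSkeletonConc G)

/-! ## §1 Transfers between `Γ ≤ G` and `G` for events determined inside `Q` -/

omit [DecidableEq V] [G.LocallyFinite] in
/-- If `Γ ≤ G` and the `G`-edges inside `Q` are `Γ`-edges, the graph weightings of `Γ` and `G` agree on the pairs inside `Q`. [folklore] -/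
theorem lattW_eq_of_le {Γ : SimpleGraph V} (hΓ : Γ ≤ G) {Q : Finset V} (hQ : ∀ u ∈ Q, ∀ v ∈ Q, G.Adj u v → Γ.Adj u v)
    (p : unitInterval) {e : Sym2 V} (he : e ∈ wireSet (↑Q : Set V)) : lattW Γ p e = lattW G p e := by
  induction e using Sym2.ind with
  | h u v =>
    obtain ⟨hu, hv, -⟩ := mk_mem_wireSet_iff.1 he
    by_cases h : G.Adj u v
    · rw [lattW_mk_of_adj _ p h, lattW_mk_of_adj _ p (hQ u (Finset.mem_coe.1 hu) v (Finset.mem_coe.1 hv) h)]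
    · rw [lattW_mk_of_not_adj _ p h, lattW_mk_of_not_adj _ p (fun h' => h (hΓ h'))]

omit [DecidableEq V] [G.LocallyFinite] in
/-- **Transfer `Γ ↔ G`**: an event determined by the pairs inside `Q` (inside `G`-edges of `Q` being `Γ`-edges, `Γ ≤ G`) has the same
probability under bond percolation on `Γ` and on `G`. [cite: KozmaNitzan2024, §4 p. 17] -/
theorem real_bondPercolation_eq_of_le [Countable V] {Γ : SimpleGraph V} (hΓ : Γ ≤ G) {Q : Finset V}
    (hQ : ∀ u ∈ Q, ∀ v ∈ Q, G.Adj u v → Γ.Adj u v) (p : unitInterval) {A : Set (BondConfig V)}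
    (hA : DeterminedBy A (wireSet (↑Q : Set V))) (hAm : MeasurableSet A) :
    (bondPercolation Γ p).real A = (bondPercolation G p).real A := by
  rw [← prodBernoulli_lattW, ← prodBernoulli_lattW]
  exact prodBernoulli_real_eq_of_determinedBy _ _ (fun e he => lattW_eq_of_le hΓ hQ p he) hA hAm

omit [G.LocallyFinite] in
/-- **Subbox transfer over any exploration graph** (generic `real_cubeEvent_eq`): `Γ ≤ G` locally finite, `Wt` a subbox weighting of `Γ`
on `D`, `Q ⊆ D` with inside `G`-edges `Γ`-edges, `A` measurable and determined inside `Q` ⟹ `P_{Wt}(A) = P_q^G(A)`.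
[cite: KozmaNitzan2024, §4 p. 17 (subbox), p. 20 ((22)–(23))] -/
theorem real_eq_of_isSubbox_of_le [Countable V] {Γ : SimpleGraph V} [Γ.LocallyFinite] (hΓ : Γ ≤ G) {Wt : Sym2 V → unitInterval}
    {q : unitInterval} {D Q : Finset V} (hWD : IsSubbox Γ Wt q D) (hQD : Q ⊆ D)
    (hQ : ∀ u ∈ Q, ∀ v ∈ Q, G.Adj u v → Γ.Adj u v) {A : Set (BondConfig V)} (hA : DeterminedBy A (wireSet (↑Q : Set V)))
    (hAm : MeasurableSet A) : (prodBernoulli Wt).real A = (bondPercolation G q).real A := by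
  rw [hWD.real_eq_bondPercolation (hA.mono (wireSet_mono (Finset.coe_subset.2 hQD))) hAm]
  exact real_bondPercolation_eq_of_le hΓ hQ q hA hAm

omit [DecidableEq V] [G.LocallyFinite] in
/-- Inside a graph ball all `G`-edges are edges of the window graph (the `winGraph` instance of the hypothesis `hQ`). [folklore] -/
theorem adj_winGraph_of_subset_graphBall {w₀ : V} {R : ℕ} {Q : Finset V} (hQR : ∀ v ∈ Q, v ∈ graphBall G w₀ R) :
    ∀ u ∈ Q, ∀ v ∈ Q, G.Adj u v → (winGraph G w₀ R).Adj u v :=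
  fun u hu v hv h => (winGraph_adj G).2 ⟨h, hQR u hu, hQR v hv⟩

/-! ## §2 The Step-IV inputs under a subbox weighting of any exploration graph -/

/-- **Cube inputs under a subbox weighting of `Γ`**: `fatSeq c M ⊆ D` with inside `G`-edges `Γ`-edges; the `P_q^G`-bounds for the zone and
the cube links at scale `M` hold under `prodBernoulli Wt`, the zone for `Γ` (antitone in the graph). [cite: KozmaNitzan2024, §4 pp. 20–21] -/
theorem inputs_at_center_of_le [Countable V] {p : unitInterval} (hC : Φ.toPlanarSkeleton.CylSubcritical p) {Γ : SimpleGraph V}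
    [Γ.LocallyFinite] (hΓ : Γ ≤ G) {q : unitInterval} {Wt : Sym2 V → unitInterval} {D : Finset V} (hWD : IsSubbox Γ Wt q D)
    {c : V} {M k : ℕ} (hQD : fatSeq Φ hC c M ⊆ D) (hQ : ∀ u ∈ fatSeq Φ hC c M, ∀ v ∈ fatSeq Φ hC c M, G.Adj u v → Γ.Adj u v)
    {δ : ℝ} (hzone : 1 - δ < (bondPercolation G q).real (UniqZone.zone G (fatSeq Φ hC c) k M))
    (hlink : ∀ g : HOct 2, 1 - δ < (bondPercolation G q).real
      (linkIn (↑(fatSeq Φ hC c M)) (fatSeq Φ hC c k) (macroPiece Φ c M (fatRadius Φ hC M) g))) :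
    1 - δ < (prodBernoulli Wt).real (UniqZone.zone Γ (fatSeq Φ hC c) k M) ∧
      ∀ g : HOct 2, 1 - δ < (prodBernoulli Wt).real
        (linkIn (↑(fatSeq Φ hC c M)) (fatSeq Φ hC c k) (macroPiece Φ c M (fatRadius Φ hC M) g)) := by
  refine ⟨?_, fun g => ?_⟩
  · rw [real_eq_of_isSubbox_of_le hΓ hWD hQD hQ (determinedBy_zone (G := Γ) (fatSeq Φ hC c) k M le_rfl)
      (measurableSet_zone (G := Γ) (fatSeq Φ hC c) k M)]
    exact hzone.trans_le (measureReal_mono (zone_anti_graph hΓ (fatSeq Φ hC c) k M) (measure_ne_top _ _))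
  · rw [real_eq_of_isSubbox_of_le hΓ hWD hQD hQ (determinedBy_linkIn (↑(fatSeq Φ hC c M)) (fatSeq Φ hC c k)
      (macroPiece Φ c M (fatRadius Φ hC M) g) le_rfl) (measurableSet_linkIn _ _ _)]
    exact hlink g

/-- **A route link under a subbox weighting of `Γ`**: `fatSeq c ℓ ⊆ D` with inside `G`-edges `Γ`-edges; the `P_q^G`-bound for the link
`fatSeq c k ↔ macroPiece c ℓ (ψ ℓ) g` inside `fatSeq c ℓ` holds under `prodBernoulli Wt`. [cite: KozmaNitzan2024, §4 p. 16, p. 21 ((24)–(25))] -/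
theorem link_center_in [Countable V] {p : unitInterval} (hC : Φ.toPlanarSkeleton.CylSubcritical p) {Γ : SimpleGraph V}
    [Γ.LocallyFinite] (hΓ : Γ ≤ G) {q : unitInterval} {Wt : Sym2 V → unitInterval} {D : Finset V} (hWD : IsSubbox Γ Wt q D)
    {c : V} {ℓ k : ℕ} (hQD : fatSeq Φ hC c ℓ ⊆ D) (hQ : ∀ u ∈ fatSeq Φ hC c ℓ, ∀ v ∈ fatSeq Φ hC c ℓ, G.Adj u v → Γ.Adj u v)
    {δ : ℝ} {g : HOct 2} (hlink : 1 - δ < (bondPercolation G q).real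
      (linkIn (↑(fatSeq Φ hC c ℓ)) (fatSeq Φ hC c k) (macroPiece Φ c ℓ (fatRadius Φ hC ℓ) g))) :
    1 - δ < (prodBernoulli Wt).real (linkIn (↑(fatSeq Φ hC c ℓ)) (fatSeq Φ hC c k) (macroPiece Φ c ℓ (fatRadius Φ hC ℓ) g)) := by
  rw [real_eq_of_isSubbox_of_le hΓ hWD hQD hQ (determinedBy_linkIn (↑(fatSeq Φ hC c ℓ)) (fatSeq Φ hC c k)
    (macroPiece Φ c ℓ (fatRadius Φ hC ℓ) g) le_rfl) (measurableSet_linkIn _ _ _)]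
  exact hlink

/-- **From a (wired) seed containing the inner prism to a target containing the route face**, under a subbox weighting of `Γ`.
[cite: KozmaNitzan2024, §4 Lemma 11 (p. 23)] -/
theorem link_seed_center_in [Countable V] {p : unitInterval} (hC : Φ.toPlanarSkeleton.CylSubcritical p) {Γ : SimpleGraph V}
    [Γ.LocallyFinite] (hΓ : Γ ≤ G) {q : unitInterval} {Wt : Sym2 V → unitInterval} {D : Finset V} (hWD : IsSubbox Γ Wt q D)
    {c : V} {ℓ k : ℕ} (hQD : fatSeq Φ hC c ℓ ⊆ D) (hQ : ∀ u ∈ fatSeq Φ hC c ℓ, ∀ v ∈ fatSeq Φ hC c ℓ, G.Adj u v → Γ.Adj u v)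
    {δ : ℝ} {g : HOct 2} (hlink : 1 - δ < (bondPercolation G q).real
      (linkIn (↑(fatSeq Φ hC c ℓ)) (fatSeq Φ hC c k) (macroPiece Φ c ℓ (fatRadius Φ hC ℓ) g)))
    {Sd T : Finset V} (hSd : fatSeq Φ hC c k ⊆ Sd) (hT : macroPiece Φ c ℓ (fatRadius Φ hC ℓ) g ⊆ T) :
    1 - δ < (prodBernoulli Wt).real (linkIn (↑(fatSeq Φ hC c ℓ)) Sd T) :=
  (link_center_in Φ hC hΓ hWD hQD hQ hlink).trans_le (measureReal_mono (linkIn_mono le_rfl hSd hT) (measure_ne_top _ _))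

/-- **The Step-IV input package of a deep contact over any exploration graph `Γ ≤ G`** (generic `stepIV_inputs_at` + `deep_h3`): scales
`M < ℓ` both in `S`, the input family at `q` with margin `δ`, a subbox weighting `Wt` of `Γ` on `D`, and a centre `c` with
`fatSeq c ℓ ⊆ D` whose inside `G`-edges are `Γ`-edges.  Then ONE `t ∈ Φ.types` gives (h1) the zone for `Γ`, (h2) the cube links at
scale `M`, (h3) for every `g` the route face `⊆ fatSeq c ℓ`, off the cube `fatSeq c M`, linked from `fatSeq c (msel t)` inside
`fatSeq c ℓ` — all with `P_{Wt} > 1 - δ` (`KNLevels.stepIV_in (G := Γ)` with `Λ := fatSeq c`, `Qt := fatSeq c ℓ`).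
[cite: KozmaNitzan2024, §4 pp. 19–21 ((21)–(25)), p. 16 (hittable)] -/
theorem exists_stepIV_inputs_of_le [Countable V] {p : unitInterval} (hC : Φ.toPlanarSkeleton.CylSubcritical p) (msel : V → ℕ)
    {S : Finset ℕ} {q : unitInterval} {δ : ℝ} (h : ∀ i ∈ inputIndex Φ S, 1 - δ < (bondPercolation G q).real (inputEvent Φ hC msel i))
    {M ℓ : ℕ} (hM : M ∈ S) (hℓ : ℓ ∈ S) (hMℓ : M < ℓ) {Γ : SimpleGraph V} [Γ.LocallyFinite] (hΓ : Γ ≤ G)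
    {Wt : Sym2 V → unitInterval} {D : Finset V} (hWD : IsSubbox Γ Wt q D)
    {c : V} (hQD : fatSeq Φ hC c ℓ ⊆ D) (hQ : ∀ u ∈ fatSeq Φ hC c ℓ, ∀ v ∈ fatSeq Φ hC c ℓ, G.Adj u v → Γ.Adj u v) :
    ∃ t ∈ Φ.types,
      1 - δ < (prodBernoulli Wt).real (UniqZone.zone Γ (fatSeq Φ hC c) (msel t) M) ∧
      (∀ g : HOct 2, 1 - δ < (prodBernoulli Wt).real
        (linkIn (↑(fatSeq Φ hC c M)) (fatSeq Φ hC c (msel t)) (macroPiece Φ c M (fatRadius Φ hC M) g))) ∧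
      ∀ g : HOct 2, macroPiece Φ c ℓ (fatRadius Φ hC ℓ) g ⊆ fatSeq Φ hC c ℓ ∧
        Disjoint (macroPiece Φ c ℓ (fatRadius Φ hC ℓ) g) (fatSeq Φ hC c M) ∧
        1 - δ < (prodBernoulli Wt).real
          (linkIn (↑(fatSeq Φ hC c ℓ)) (fatSeq Φ hC c (msel t)) (macroPiece Φ c ℓ (fatRadius Φ hC ℓ) g)) := by
  obtain ⟨t, ht, hall⟩ := exists_inputs_at_center_all Φ hC msel h c
  have hsub : fatSeq Φ hC c M ⊆ fatSeq Φ hC c ℓ := fatSeq_monotone Φ hC c hMℓ.le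
  have hMD : fatSeq Φ hC c M ⊆ D := hsub.trans hQD
  have hMQ : ∀ u ∈ fatSeq Φ hC c M, ∀ v ∈ fatSeq Φ hC c M, G.Adj u v → Γ.Adj u v :=
    fun u hu v hv huv => hQ u (hsub hu) v (hsub hv) huv
  obtain ⟨h1, h2⟩ := inputs_at_center_of_le Φ hC hΓ hWD hMD hMQ (hall M hM).1 (hall M hM).2
  exact ⟨t, ht, h1, h2, fun g => ⟨macroPiece_subset_fatSeq Φ hC c ℓ g, disjoint_macroPiece_fatSeq Φ hC c hMℓ _ g,
    link_center_in Φ hC hΓ hWD hQD hQ ((hall ℓ hℓ).2 g)⟩⟩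

/-- **The straight route discharges the per-contact hypothesis `hcon` of the generic kit clause** (lane ruling 2026-08-20, shape of
hp-8 g24 / p3-g4): if a route prism `fatSeq c ℓ ⊆ D` (`ℓ ∈ S`, `M < ℓ`, inside `G`-edges `Γ`-edges) has a quarter-face
`macroPiece c ℓ (ψ ℓ) g ⊆ T`, then for every representative `t` carrying the inputs at `c` (all scales of `S`, inner scale `msel t`) the
probabilistic route exists: `Qt := fatSeq c ℓ`, `Ft :=` the quarter-face — `Ft ⊆ T`, `Qt ⊆ D`, `Ft` off the cube `fatSeq c M`, and
`P_{Wt}(fatSeq c (msel t) ↔ Ft inside Qt) > 1 - δ`. [cite: KozmaNitzan2024, §4 p. 16 (hittable), Lemma 11 (p. 23)] -/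
theorem hcon_of_straight [Countable V] {p : unitInterval} (hC : Φ.toPlanarSkeleton.CylSubcritical p) {Γ : SimpleGraph V}
    [Γ.LocallyFinite] (hΓ : Γ ≤ G) {q : unitInterval} {Wt : Sym2 V → unitInterval} {D T : Finset V} (hWD : IsSubbox Γ Wt q D)
    {c : V} {M ℓ : ℕ} {S : Finset ℕ} (hℓ : ℓ ∈ S) (hMℓ : M < ℓ) (hQD : fatSeq Φ hC c ℓ ⊆ D)
    (hQ : ∀ u ∈ fatSeq Φ hC c ℓ, ∀ v ∈ fatSeq Φ hC c ℓ, G.Adj u v → Γ.Adj u v) {g : HOct 2}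
    (hT : macroPiece Φ c ℓ (fatRadius Φ hC ℓ) g ⊆ T) {msel : V → ℕ} {δ : ℝ} {t : V}
    (hin : ∀ M' ∈ S, 1 - δ < (bondPercolation G q).real (UniqZone.zone G (fatSeq Φ hC c) (msel t) M') ∧
      ∀ g' : HOct 2, 1 - δ < (bondPercolation G q).real
        (linkIn (↑(fatSeq Φ hC c M')) (fatSeq Φ hC c (msel t)) (macroPiece Φ c M' (fatRadius Φ hC M') g'))) :
    ∃ Qt Ft : Finset V, Ft ⊆ T ∧ Qt ⊆ D ∧ (∀ u ∈ Qt, ∀ v ∈ Qt, G.Adj u v → Γ.Adj u v) ∧ Disjoint Ft (fatSeq Φ hC c M) ∧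
      1 - δ < (prodBernoulli Wt).real (linkIn (↑Qt) (fatSeq Φ hC c (msel t)) Ft) :=
  ⟨fatSeq Φ hC c ℓ, macroPiece Φ c ℓ (fatRadius Φ hC ℓ) g, hT, hQD, hQ, disjoint_macroPiece_fatSeq Φ hC c hMℓ _ g,
    link_center_in Φ hC hΓ hWD hQD hQ ((hin ℓ hℓ).2 g)⟩

end Skel

end Transplant

end Summit.CriticalPhenomena.PercolationContinuityZ3.Theorems

end
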